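import Literature.AlgebraicGeometry.HodgeTheory.AlgebraicClasses
import Literature.AlgebraicGeometry.HodgeTheory.RationalHodgeClasses
import Literature.Geometry.Kaehler.HolomorphicLineBundle
import Literature.Geometry.Kaehler.MilnorSymbolCocycle
import Literature.Geometry.Kaehler.CechDeRhamTransgression
import HarnessLib

/-!
# Symbol classes: cohomology classes carried by Čech cocycles of holomorphic Milnor symbols

Layer `Literature/AlgebraicGeometry/HodgeTheory`. Carriers of the route `MilnorKExponential` of the
Hodge summit (the subspace `Lᵖ ⊆ H²ᵖ(X(ℂ); ℂ)` of RATIONAL SYMBOL CLASSES, `Algᵖ ⊆ Lᵖ ⊆ Hdgᵖ`),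
stated over the tree's `HodgeModel n X` (analytification `X^an` + a natural de Rham comparison
`A.deRham`) with the notions of `Literature/Geometry/Kaehler/MilnorSymbolCocycle` (holomorphic
units, the naive Milnor relations `milnorRel`, the symbol forms `symbolForm σ = Σ n · dlog f₁ ∧ ⋯ ∧
dlog f_p`, Milnor symbol cocycles `IsMilnorSymbolCocycle`, the cup powers `L.symbolCochain q` of the
transition cocycle of a holomorphic line bundle) and of
`Literature/Geometry/Kaehler/CechDeRhamTransgression` (`IsTransgression`: the Bott–Tu zigzag
through the Čech–de Rham double complex, Bott–Tu (1982), §8, Prop. 8.8).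

Mathematics. On a complex manifold the symbol map `{f₁, …, f_p} ↦ dlog f₁ ∧ ⋯ ∧ dlog f_p` sends the
analytic Milnor `K`-sheaf `𝒦^M_{p,an}` to closed holomorphic `p`-forms (Bloch, *Lectures on algebraic
cycles*, Lecture 6: "the existence of a dlog map `𝒦₂^an → Ω²_{X^an}`", and the map
`CH²(X) ≅ H²(X^Zar, 𝒦₂) → H²(X^an, 𝒦₂^an)`; Esnault (1990) for the analytic sheaf `𝒦₂` and its cycle
map), whence `Ȟᵖ(X^an, 𝒦^M_{p,an}) → Hᵖ(Ω^p_cl) → H²ᵖ_dR(X^an; ℂ)`, the last arrow being the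
transgression through the Čech–de Rham double complex `K^{a,b} = Čᵃ(𝔘, 𝒜ᵇ)` (Voisin I, proof of
Thm. 7.10, does exactly this for `p = 1`: the cocycle `(g_ij)` of a holomorphic line bundle, its
logarithm, and the class `c₁(L)`; Bott–Tu (1982), Prop. 8.8). A class `c ∈ H²ᵖ(X(ℂ); ℂ)`,
`p = q + 1`, is a SYMBOL CLASS when a non-zero integer multiple of (the pull-back to `X^an` of) `c`
is such a transgression of a Čech `p`-cocycle of `ℤ`-combinations of symbols of holomorphic units,
cocycle modulo the Milnor relations.

* `HodgeModel.IsSymbolNormalized A q` — the de Rham comparison of the model `A` is normalised in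
  degree `2q + 2`: the `(q+1)`-fold cup power `L.symbolCochain q = [g_{J₀J₁}, …, g_{J_qJ_{q+1}}]` of
  the transition cocycle of SOME holomorphic line bundle (finite trivialising cover) transgresses to
  a closed `(2q+2)`-form whose class is, under `A.deRham`, the pull-back of a NON-ZERO RATIONAL class
  (this pins the free scalar of the comparison `A.deRham` in that degree into `(2πi)^{-(q+1)} ℚˣ`).
* `HodgeModel.HasSymbolCocycle A q c` — on the model `A`: a finite open cover, a Milnor symbol
  `(q+1)`-cocycle `σ` of weight `q + 1` of it (`IsMilnorSymbolCocycle`: chains of good tuples of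
  holomorphic units, cocycle modulo `milnorRel`), and a closed `(2q+2)`-form `θ` transgressing the
  symbol forms of `σ`, with `A.deRham [θ] = m • A^*(c)` for an integer `m ≠ 0`.
* `IsSymbolClass n X q c` — `c ∈ H^{2(q+1)}(X(ℂ); ℂ)` is a symbol class of weight `q + 1`: for SOME
  Hodge model `A`, normalised in degree `2q + 2` whenever that cohomology group is non-zero,
  `A.HasSymbolCocycle q c`.

## Relation to the route's inlined statements (design note)

Route `MilnorKExponential` (items `stmt-HodgeConjecture-17743 … 17746`) ships these notions INLINED
as `∃ A : HodgeModel n X, <normalised A q> ∧ <symbol cocycle for c on A>`. `A.IsSymbolNormalized q`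
is DEFINITIONALLY the first clause; `A.HasSymbolCocycle q c` is the second clause with its two
hypotheses "`σ_J` is a chain of good tuples on `U_J`" and "`δσ ∈ milnorRel` on `U_{J'}`" bundled as
`IsMilnorSymbolCocycle A.model U σ` (definitionally the same two statements). `IsSymbolClass` adds
exactly one guard: normalisation is demanded only under `Nontrivial (complexBetti X (2 * (q + 1)))`.
Without it the inlined notion is never satisfied when `H^{2q+2}(X(ℂ); ℂ) = 0` — e.g. `X = ℙ⁰`,
`q = 0`, `c = 0` — although `0` is a symbol class (zero cocycle), so that "every rational
`(q+1,q+1)`-class is a symbol class" would fail for the zero class in degrees `> 2 dim X` for vacuous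
reasons. With the guard: `isSymbolClass_of_subsingleton` (all classes, i.e. `0`, are symbol classes
when the group vanishes) and `isSymbolClass_iff_of_nontrivial` (the inlined shape whenever the group
is non-zero, in particular for every `c ≠ 0`, and for all `q + 1 ≤ dim X` by
`IsKaehlerClass.cupPowTwo_ne_zero` with `exists_isKaehlerClass` of `HodgeTheory/KaehlerClass`);
`HodgeModel.IsSymbolNormalized.nontrivial` shows the guard costs nothing else.

## What is NOT here

No claim that symbol classes form a subspace (only `IsSymbolClass.neg/zsmul/of_zsmul`, which need
no common refinement of covers), are of Hodge type `(p,p)`, contain the algebraic classes, or are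
algebraic (these are the route's items); no sheaf `𝒦^M_{p,an}` (the tree has no sheaf cohomology:
cocycles of one finite cover, relations imposed naively on each `U_J`); no existence of normalised
models (expected from `𝒪(1)` and `h^{q+1} ≠ 0`; a separate computation).

## References

* S. Bloch, *Lectures on Algebraic Cycles*, 2nd ed. (2010), Lecture 6 (analytic `𝒦₂`, `dlog`).
* H. Esnault, *A note on the cycle map*, J. reine angew. Math. 411 (1990), 51–65, §3.
* H. Esnault, E. Viehweg, *Deligne–Beilinson cohomology* (1988), §7.
* C. Voisin, *Hodge Theory and Complex Algebraic Geometry I* (2002), Thm. 4.49, Thm. 7.10 (proof).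
* R. Bott, L. W. Tu, *Differential Forms in Algebraic Topology* (1982), §8, Prop. 8.8.
-/

noncomputable section

open scoped Manifold ContDiff

namespace Literature.AlgebraicGeometry.HodgeTheory

open Literature.Geometry.Kaehler Literature.NumberTheory.Transcendental

section HodgeTheory

variable {n : ℕ} {X : Motives.SchemeOver ℂ}

namespace HodgeModel

/-- **The de Rham comparison of the Hodge model `A` is symbol-normalised in degree `2q + 2`**:
there are a holomorphic line bundle `L` on `X^an = A.carrier` presented by a cocycle `(g_ij)` on a
FINITE trivialising cover, a closed complex `(2q+2)`-form `θ₀` and a class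
`c₀ ∈ H^{2q+2}(X(ℂ); ℂ)` such that `θ₀` is a Čech–de Rham transgression (Bott–Tu zigzag,
`IsTransgression`) of the Čech `(q+1)`-cochain of symbol forms
`dlog g_{J₀J₁} ∧ ⋯ ∧ dlog g_{J_qJ_{q+1}}` of the cup powers `L.symbolCochain q` of the transition
cocycle, `c₀` is RATIONAL and NON-ZERO, and `A.deRham [θ₀] = A^*(c₀)`. For `q = 0` this is the
computation of `c₁(L)` from the cocycle `(g_ij)` through the double complex `Čᵇ(𝔘, 𝒜ᵃ)`
(Voisin I, proof of Thm. 7.10); requiring the class to be rational and non-zero pins the scalar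
by which the natural comparison `A.deRham` may differ, in this degree, from integration of forms.
Satisfiable only when `H^{2q+2}(X(ℂ); ℂ) ≠ 0` (`IsSymbolNormalized.nontrivial`).
[cite: VoisinHodgeI2002, Thm. 7.10 (proof)] -/
def IsSymbolNormalized (A : HodgeModel n X) (q : ℕ) : Prop :=
  ∃ (ι : Type) (_ : Fintype ι) (L : HolomorphicLineBundle ι A.model A.carrier)
    (θ₀ : cclosedSmoothForms A.model A.carrier (2 * q + 1 + 1)) (c₀ : complexBetti X (2 * q + 1 + 1)),
    IsTransgression L.isOpen_baseSet q (fun J ↦ symbolForm A.model (q + 1) (L.symbolCochain q J)) θ₀ ∧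
      IsRationalClass c₀ ∧ c₀ ≠ 0 ∧
        A.deRham A.carrier (2 * q + 1 + 1)
            (complexDeRhamCohomology.mk A.model A.carrier (2 * q + 1 + 1) θ₀) =
          A.pullback (2 * q + 1 + 1) c₀

/-- **The class `c ∈ H^{2(q+1)}(X(ℂ); ℂ)` is carried, on the Hodge model `A`, by a Čech cocycle
of holomorphic Milnor symbols of weight `q + 1`**: there are a finite open cover `𝔘 = (U_i)` of
`X^an = A.carrier`, a Milnor symbol `(q+1)`-cocycle `σ` of weight `q + 1` of `𝔘`
(`IsMilnorSymbolCocycle`: each `σ_J`, `J` an ordered `(q+2)`-tuple, is a `ℤ`-combination of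
`(q+1)`-tuples of holomorphic units on `U_J`, and `(δσ)_{J'}` lies in the naive Milnor relations
`milnorRel` over `U_{J'}` — multilinearity and Steinberg — for every `(q+3)`-tuple `J'`), a closed
complex `(2q+2)`-form `θ` which is a Čech–de Rham transgression of the symbol forms
`J ↦ Σ n · dlog f₁ ∧ ⋯ ∧ dlog f_{q+1}` of `σ` (`IsTransgression`, Bott–Tu §8), and an integer
`m ≠ 0` with `A.deRham [θ] = m • A^*(c)`. This is the chain-level form of
"`m · c` lies in the image of `Ȟ^{q+1}(X^an, 𝒦^M_{q+1,an}) → H^{q+1}(Ω^{q+1}_cl) → H^{2q+2}(X; ℂ)`"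
(Bloch, Lecture 6: the analytic sheaf `𝒦₂^an`, its `dlog` map to `Ω²`, and
`CH² ≅ H²(𝒦₂) → H²(X^an, 𝒦₂^an)`; Esnault (1990), §3).
[cite: BlochLectures2010, Lecture 6 (proof of Thm. 6.1)] -/
def HasSymbolCocycle (A : HodgeModel n X) (q : ℕ) (c : complexBetti X (2 * (q + 1))) : Prop :=
  ∃ (ι : Type) (_ : Fintype ι) (U : ι → Set A.carrier) (hU : ∀ i, IsOpen (U i))
    (_ : ∀ x, ∃ i, x ∈ U i) (σ : (Fin (q + 2) → ι) → ((Fin (q + 1) → (A.carrier → ℂ)) →₀ ℤ))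
    (_ : IsMilnorSymbolCocycle A.model U σ)
    (θ : cclosedSmoothForms A.model A.carrier (2 * q + 1 + 1)) (m : ℤ),
    m ≠ 0 ∧ IsTransgression hU q (fun J ↦ symbolForm A.model (q + 1) (σ J)) θ ∧
      A.deRham A.carrier (2 * q + 1 + 1)
          (complexDeRhamCohomology.mk A.model A.carrier (2 * q + 1 + 1) θ) =
        (m : ℂ) • A.pullback (2 * q + 1 + 1) c

end HodgeModel

/-- **Symbol classes of weight `q + 1`** (the `L^{q+1}` of the Milnor-`K` / weight-`p` exponential
sequence line of the Hodge summit): `c ∈ H^{2(q+1)}(X(ℂ); ℂ)` is a symbol class if for SOME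
Hodge model `A` of `X` — whose de Rham comparison is symbol-normalised in degree `2q + 2`
(`HodgeModel.IsSymbolNormalized`) as soon as `H^{2(q+1)}(X(ℂ); ℂ) ≠ 0` — a non-zero integer
multiple of `A^*(c)` is the de Rham class of a Čech–de Rham transgression of a Milnor symbol
cocycle (`HodgeModel.HasSymbolCocycle`). The guard `Nontrivial _ →` only removes the vacuous failure
of normalisation in degrees where the cohomology group is zero (module docstring); for `c ≠ 0`, or
whenever the group is non-zero, this is literally `∃ A, A.IsSymbolNormalized q ∧ A.HasSymbolCocycle q c`
(`isSymbolClass_iff_of_nontrivial`). [cite: BlochLectures2010, Lecture 6 (proof of Thm. 6.1)] -/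
def IsSymbolClass (n : ℕ) (X : Motives.SchemeOver ℂ) (q : ℕ) (c : complexBetti X (2 * (q + 1))) :
    Prop :=
  ∃ A : HodgeModel n X,
    (Nontrivial (complexBetti X (2 * (q + 1))) → A.IsSymbolNormalized q) ∧ A.HasSymbolCocycle q c

/-! ### API -/

/-- A symbol-normalisation witness lives in a non-zero cohomology group (its rational class `c₀`
is non-zero). [folklore] -/
theorem HodgeModel.IsSymbolNormalized.nontrivial {A : HodgeModel n X} {q : ℕ}
    (h : A.IsSymbolNormalized q) : Nontrivial (complexBetti X (2 * (q + 1))) := by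
  obtain ⟨_, _, _, _, c₀, _, _, hc₀, _⟩ := h
  exact nontrivial_of_ne c₀ 0 hc₀

/-- **The zero class has the zero symbol cocycle** on every Hodge model: one-set cover, `σ = 0`
(`isMilnorSymbolCocycle_zero`), `θ = 0`, `m = 1`, and the zero zigzag. [folklore] -/
theorem HodgeModel.hasSymbolCocycle_zero (A : HodgeModel n X) (q : ℕ) : A.HasSymbolCocycle q 0 := by
  refine ⟨Unit, inferInstance, fun _ ↦ Set.univ, fun _ ↦ isOpen_univ, fun x ↦ ⟨(), Set.mem_univ x⟩,
    0, isMilnorSymbolCocycle_zero _, 0, 1, one_ne_zero, ?_, ?_⟩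
  · refine ⟨fun _ _ ↦ 0, fun J x _ ↦ ?_, fun a b _ _ ↦ ?_, fun J x _ ↦ ?_⟩
    · simp only [map_zero, Pi.zero_apply, symbolForm_zero, ZeroMemClass.coe_zero]
    · simp only [map_zero]
    · simp only [map_zero, Pi.zero_apply, ZeroMemClass.coe_zero]
  · simp only [map_zero, Int.cast_one, one_smul]

/-- **Symbol cocycles may be negated**: `-σ` (`IsMilnorSymbolCocycle.neg`), `-θ`
(`IsTransgression.neg`, `symbolForm_neg`), same `m`. [folklore] -/
theorem HodgeModel.HasSymbolCocycle.neg {A : HodgeModel n X} {q : ℕ}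
    {c : complexBetti X (2 * (q + 1))} (h : A.HasSymbolCocycle q c) : A.HasSymbolCocycle q (-c) := by
  obtain ⟨ι, _, U, hU, hcov, σ, hσ, θ, m, hm, hT, hc⟩ := h
  refine ⟨ι, ‹_›, U, hU, hcov, -σ, hσ.neg, -θ, m, hm, ?_, ?_⟩
  · have e : (fun J ↦ symbolForm A.model (q + 1) ((-σ) J)) =
        -fun J ↦ symbolForm A.model (q + 1) (σ J) := by
      funext J
      simp only [Pi.neg_apply, symbolForm_neg]
    rw [e, Submodule.coe_neg]
    exact hT.neg
  · rw [map_neg, map_neg, hc, map_neg, smul_neg]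

/-- **Symbol cocycles may be multiplied by integers**: `k • σ` (Milnor symbol cocycles form the
subgroup `milnorSymbolCocycles`), `(k : ℂ) • θ` (`IsTransgression.smul`, `symbolFormHom`), same `m`.
[folklore] -/
theorem HodgeModel.HasSymbolCocycle.zsmul {A : HodgeModel n X} {q : ℕ}
    {c : complexBetti X (2 * (q + 1))} (h : A.HasSymbolCocycle q c) (k : ℤ) :
    A.HasSymbolCocycle q (k • c) := by
  obtain ⟨ι, _, U, hU, hcov, σ, hσ, θ, m, hm, hT, hc⟩ := h
  have hσk : IsMilnorSymbolCocycle A.model U (k • σ) :=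
    (milnorSymbolCocycles A.model U (q + 1) (q + 1)).zsmul_mem hσ k
  refine ⟨ι, ‹_›, U, hU, hcov, k • σ, hσk, (k : ℂ) • θ, m, hm, ?_, ?_⟩
  · have hk : ∀ s : (Fin (q + 1) → (A.carrier → ℂ)) →₀ ℤ,
        symbolForm A.model (q + 1) (k • s) = k • symbolForm A.model (q + 1) s :=
      fun s ↦ map_zsmul (symbolFormHom A.model (q + 1)) k s
    have e : (fun J ↦ symbolForm A.model (q + 1) ((k • σ) J)) =
        (k : ℝ) • fun J ↦ symbolForm A.model (q + 1) (σ J) := by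
      funext J
      simp only [Pi.smul_apply, hk, Int.cast_smul_eq_zsmul]
    have e' : (((k : ℂ) • θ : cclosedSmoothForms A.model A.carrier (2 * q + 1 + 1)) :
          MForm 𝓘(ℝ, A.model) A.carrier ℂ (2 * q + 1 + 1)) =
        (k : ℝ) • (θ : MForm 𝓘(ℝ, A.model) A.carrier ℂ (2 * q + 1 + 1)) := by
      rw [Submodule.coe_smul, Int.cast_smul_eq_zsmul, Int.cast_smul_eq_zsmul]
    rw [e, e']
    exact hT.smul (k : ℝ)
  · rw [map_smul, map_smul, hc, map_zsmul, ← Int.cast_smul_eq_zsmul ℂ k, smul_comm]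

/-- **Saturation**: a symbol cocycle for a non-zero integer multiple `k • c` is one for `c`
(replace `m` by `m k`; this is what the integer `m ≠ 0` in the definition is for). [folklore] -/
theorem HodgeModel.HasSymbolCocycle.of_zsmul {A : HodgeModel n X} {q : ℕ}
    {c : complexBetti X (2 * (q + 1))} {k : ℤ} (hk : k ≠ 0) (h : A.HasSymbolCocycle q (k • c)) :
    A.HasSymbolCocycle q c := by
  obtain ⟨ι, _, U, hU, hcov, σ, hσ, θ, m, hm, hT, hc⟩ := h
  refine ⟨ι, ‹_›, U, hU, hcov, σ, hσ, θ, m * k, mul_ne_zero hm hk, hT, ?_⟩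
  rw [hc, map_zsmul, ← Int.cast_smul_eq_zsmul ℂ k, smul_smul, Int.cast_mul]

/-- Constructor: a symbol cocycle on a symbol-normalised model gives a symbol class. [folklore] -/
theorem IsSymbolClass.of_hasSymbolCocycle {q : ℕ} {c : complexBetti X (2 * (q + 1))}
    (A : HodgeModel n X) (hN : A.IsSymbolNormalized q) (hc : A.HasSymbolCocycle q c) :
    IsSymbolClass n X q c :=
  ⟨A, fun _ ↦ hN, hc⟩

/-- A symbol class has, in particular, a Hodge model. [folklore] -/
theorem IsSymbolClass.nonempty_hodgeModel {q : ℕ} {c : complexBetti X (2 * (q + 1))}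
    (h : IsSymbolClass n X q c) : Nonempty (HodgeModel n X) :=
  ⟨h.choose⟩

/-- **When `H^{2(q+1)}(X(ℂ); ℂ) ≠ 0` a symbol class is literally "a symbol cocycle on a
symbol-normalised Hodge model"** — the shape inlined by route `MilnorKExponential`. [folklore] -/
theorem isSymbolClass_iff_of_nontrivial {q : ℕ} [Nontrivial (complexBetti X (2 * (q + 1)))]
    {c : complexBetti X (2 * (q + 1))} :
    IsSymbolClass n X q c ↔ ∃ A : HodgeModel n X, A.IsSymbolNormalized q ∧ A.HasSymbolCocycle q c :=
  ⟨fun ⟨A, hN, hc⟩ ↦ ⟨A, hN ‹_›, hc⟩, fun ⟨A, hN, hc⟩ ↦ ⟨A, fun _ ↦ hN, hc⟩⟩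

/-- A NON-ZERO symbol class comes with a symbol-normalised model carrying its cocycle. [folklore] -/
theorem IsSymbolClass.exists_isSymbolNormalized {q : ℕ} {c : complexBetti X (2 * (q + 1))}
    (h : IsSymbolClass n X q c) (hc : c ≠ 0) :
    ∃ A : HodgeModel n X, A.IsSymbolNormalized q ∧ A.HasSymbolCocycle q c :=
  haveI := nontrivial_of_ne c 0 hc
  isSymbolClass_iff_of_nontrivial.1 h

/-- **When `H^{2(q+1)}(X(ℂ); ℂ) = 0` every class (i.e. `0`) is a symbol class**, as soon as a
Hodge model exists (zero cocycle; the normalisation guard is void). [folklore] -/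
theorem isSymbolClass_of_subsingleton {q : ℕ} [Subsingleton (complexBetti X (2 * (q + 1)))]
    (A : HodgeModel n X) (c : complexBetti X (2 * (q + 1))) : IsSymbolClass n X q c := by
  obtain rfl : c = 0 := Subsingleton.elim _ _
  exact ⟨A, fun h ↦ (not_nontrivial _ h).elim, A.hasSymbolCocycle_zero q⟩

/-- **Symbol classes are stable under negation.** [folklore] -/
theorem IsSymbolClass.neg {q : ℕ} {c : complexBetti X (2 * (q + 1))} (h : IsSymbolClass n X q c) :
    IsSymbolClass n X q (-c) :=
  let ⟨A, hN, hc⟩ := h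
  ⟨A, hN, hc.neg⟩

/-- **Symbol classes are stable under integer multiples.** [folklore] -/
theorem IsSymbolClass.zsmul {q : ℕ} {c : complexBetti X (2 * (q + 1))} (h : IsSymbolClass n X q c)
    (k : ℤ) : IsSymbolClass n X q (k • c) :=
  let ⟨A, hN, hc⟩ := h
  ⟨A, hN, hc.zsmul k⟩

/-- **Symbol classes are saturated**: if `k • c` is a symbol class for an integer `k ≠ 0`, so is
`c`. [folklore] -/
theorem IsSymbolClass.of_zsmul {q : ℕ} {c : complexBetti X (2 * (q + 1))} {k : ℤ} (hk : k ≠ 0)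
    (h : IsSymbolClass n X q (k • c)) : IsSymbolClass n X q c :=
  let ⟨A, hN, hc⟩ := h
  ⟨A, hN, hc.of_zsmul hk⟩

end HodgeTheory

end Literature.AlgebraicGeometry.HodgeTheory
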